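import Literature.Barriers.QuantumFields.PerturbativeInvisibility
import Literature.Barriers.QuantumFields.FixedCouplingUltralocality
import HarnessLib

/-!
# Barrier: the weak-coupling pairing scale `W e^{-1/(αρ²U²)}` is invisible to finite-order perturbation theory in `U`

Barrier catalogue `Literature/Barriers/HubbardSuperconductivity/` (D-0021), entry
`PerturbativeInvisibilityOfPairing`, summit `HubbardSuperconductivity` (`d_{x²-y²}` pair-field
long-range order in the ground states of the doped repulsive square-lattice Hubbard model, some
`U > 0`). It records, as a **proved theorem**, the elementary analytic fact behind the standard
statement that superconductivity of the weakly repulsive Hubbard model cannot be seen at any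
finite order of the expansion in `U/t` around the free Fermi gas — the Hubbard analogue of
`Literature/Barriers/QuantumFields/PerturbativeInvisibility.lean`, whose technique class
`Literature.Barriers.QuantumFields.IsPerturbativelyVisibleAt0` (some order `n` and coefficient `a ≠ 0`
with `f(g)/gⁿ → a` as `g → 0⁺`) and flatness lemma `tendsto_rpow_neg_mul_exp_neg_div_sq`
(`g^{−k} e^{−c/g²} → 0`) are reused here, together with `tendsto_rpow_neg_mul_exp_neg_div`
(`g^{−k} e^{−c/g} → 0`) of `Literature/Barriers/QuantumFields/FixedCouplingUltralocality.lean`.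

## Sources (as printed)

* Arovas–Berg–Kivelson–Raghu, *The Hubbard Model*, Annu. Rev. CMP 13 (2022)
  (`ArovasBergKivelsonRaghu2022`, held as `paper:arxiv-2103.12097`), §5.1.1 (p. 9 of the arXiv
  version): "Corrections to all quantities can be expressed as an asymptotic series in `U/t`.
  Clearly, at zero temperature, the radius of convergence of this series is zero, since the
  behavior is qualitatively distinct for `U/t → 0⁻` and `U/t → 0⁺`: When `U/t → 0⁻`, BCS
  mean-field theory is asymptotically exact, and there is a superconducting instability below a
  characteristic scale `T_{c,−} ∼ exp[−1/(ρ|U|)]`, where `ρ` is the density of states at the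
  Fermi energy. … When `U/t → 0⁺` … the superconductivity itself sets in below a parametrically
  lower scale `T_{c,+} ∼ exp[−1/(αρ²U²)] ≪ T_{c,−}`, where `α` is an order unity constant that
  depends on the entire band structure"; p. 10: "the ground states on either side of `U/t = 0`
  are not adiabatically connected. The point `U/t = 0` is a peculiar multi-critical point … a
  subclass of perturbative corrections represented diagrammatically by ladders in the
  particle-particle (BCS) channel are logarithmically divergent so long as either time-reversal
  symmetry or inversion symmetry are present in the normal state"; §5.1.3 (p. 13): "the only
  characteristic scale, namely the bandwidth `W` determines the superconducting instability:
  `T_c ∼ W exp[−1/(αρ²U²)]`", and Fig. 1(a): for the square lattice with `t' = 0` "the dominant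
  instability of the system in the weak-coupling limit is to a d-wave superconductor near
  half-filling".
* Raghu–Kivelson–Scalapino, PRB 81 (2010) 224505 (`RaghuKivelsonScalapino2010`, held as
  `paper:arxiv-1002.0591`), §I (p. 2): "For repulsive interactions, `W ≫ U > 0`, the
  superconducting transition temperature has an asymptotic expansion [eq. (2)] where `α_n` are
  dimensionless functions of `t'/t`, `n` and `ρ` … asymptotically exact"; §IV (p. 9): "At any
  given temperature, the thermodynamic properties of the model can be computed perturbatively in
  powers of `U/t` so long as `U/t` is small compared to a characteristic `T` dependent magnitude
  … even at `T = 0`, if we introduce an artificial low energy cutoff … low order perturbation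
  theory is reliable so long as `Ω > Ω_PT`", `Ω_PT` being set by "the most divergent terms in each
  order of perturbation theory, the familiar particle-particle ladders".

## Contents (all proved)

* `repulsivePairingScale W α ρ U = W · exp(−1/(α ρ² U²))` — the printed weak-coupling scale
  `T_{c,+}` of the repulsive model (ABKR §5.1.1, §5.1.3); it is LITERALLY the tree's
  `asymptoticScalingMass W (αρ²/2) 0` (`repulsivePairingScale_eq_asymptoticScalingMass`), so its
  flatness, non-visibility and little-o form are DERIVED from `PerturbativeInvisibility_holds`,
  `not_isPerturbativelyVisibleAt0_asymptoticScalingMass`, `asymptoticScalingMass_isLittleO`;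
  `attractivePairingScale W ρ U = W · exp(−1/(ρ U))` — the BCS scale `T_{c,−}` of the attractive
  model, `U = |U_attr|` (genuinely not an instance: `e^{−c/U}`), proved here from the tree's
  `tendsto_rpow_neg_mul_exp_neg_div`.
* `PerturbativeInvisibilityOfPairing` (headline, proved in `PerturbativeInvisibilityOfPairing_holds`):
  for `α, ρ > 0` and every `W`, neither scale is `IsPerturbativelyVisibleAt0`; flatness forms
  `repulsivePairingScale_flat` (derived), `attractivePairingScale_flat` (`scale/Uⁿ → 0` for every `n`).
* `repulsivePairingScale_le_attractive` — `T_{c,+} ≤ T_{c,−}` once `αρU ≤ 1` (the printed `≪`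
  in its weakest exact form).

## Narrowing (barrier audit 2026-08-14, appended; all proved)

The technique class `IsPerturbativelyVisibleAt0` is a predicate on the OUTPUT function
`U ↦ T_c(U)`; it is not invariant under the fixed, explicit BCS change of the dependent variable
`λ ↦ W e^{−1/λ}`. The appended block makes both directions of this remark theorems:

* `bcsScaleOfCoupling W λ U = W · exp(−1/λ(U))` (the BCS dictionary, coupling ↦ scale) and
  `couplingOfScale W f U = −1 / log(f(U)/W)` (scale ↦ coupling), with
  `couplingOfScale_bcsScaleOfCoupling` (`W ≠ 0`: a left inverse for EVERY `λ`, junk included),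
  `repulsivePairingScale W α ρ = bcsScaleOfCoupling W (αρ²U²)`,
  `attractivePairingScale W ρ = bcsScaleOfCoupling W (ρU)` (both `rfl`).
* `isPerturbativelyVisibleAt0_couplingOfScale_repulsivePairingScale` /
  `…_attractivePairingScale`: the Cooper-channel couplings `−1/log(T_{c,+}/W) = αρ²U²` and
  `−1/log(T_{c,−}/W) = ρU` ARE perturbatively visible (orders `2`, `1`), although `T_{c,±}` are
  not; `isPerturbativelyVisibleAt0_not_invariant_under_couplingOfScale` (explicit witness).
* `mul_exp_neg_one_div_flat`: eventually `0 < λ(U) ≤ C U` and `|A(U)| ≤ B` give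
  `A(U) e^{−1/λ(U)} / Uⁿ → 0` for every `n`; `bcsScaleOfCoupling_flat` and
  `not_isPerturbativelyVisibleAt0_bcsScaleOfCoupling`: every coupling visible at an order
  `n ≥ 1` with coefficient `a > 0` has a flat, non-visible BCS image — this covers the full
  printed form of the exponent, `α₂(ρU)² + α₃(ρU)³ + …` with any bounded prefactor, not only the
  two leading laws.
* `PerturbativeInvisibilityOfPairingNarrow` (the sharpened barrier, both conjuncts) with
  `PerturbativeInvisibilityOfPairingNarrow_holds` and
  `PerturbativeInvisibilityOfPairing_of_narrow` (it implies the catalogued statement).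

Literature read for the audit (page hits in the block's docstring): Kohn–Luttinger via
Salmhofer 1999 §4.5.4; Nomura–Yamada third/fourth-order vertex + Dyson–Gor'kov equation
(Yamada 2004 §9); bold diagrammatic Monte Carlo for the irreducible particle–particle vertex
(Deng–Kozik–Prokof'ev–Svistunov 2015); renormalised perturbation theory with symmetry-breaking
counterterms (Neumayr–Metzner 2003; rigorous long-range BCS analogue Mastropietro 2008 Ch. 15);
rigorous weak-coupling asymptotics of the BCS functional stated in the coupling variable
(Hainzl–Seiringer 2016, Thms 3.2–3.3); resurgent large-order visibility of the gap
(Mariño–Reis 2022).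

## Mathlib / tree search

Tree: `Literature.Barriers.QuantumFields.IsPerturbativelyVisibleAt0`, `asymptoticScalingMass`,
`PerturbativeInvisibility_holds`, `not_isPerturbativelyVisibleAt0_asymptoticScalingMass`,
`asymptoticScalingMass_isLittleO` (`PerturbativeInvisibility.lean`; the repulsive scale is an
instance, `β₀ = αρ²/2`, `β₁ = 0`) and `tendsto_rpow_neg_mul_exp_neg_div`
(`FixedCouplingUltralocality.lean`), all reused — only the attractive `e^{−c/U}` half has its own
(three-line) flatness proof; `Barriers/HubbardSuperconductivity/WeakCouplingCeiling.lean`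
(the Cooper logarithm behind the `e^{-const/|λ|}` temperature ceiling of convergent expansions).
Mathlib: `tendsto_rpow_mul_exp_neg_mul_atTop_nhds_zero`, `tendsto_inv_nhdsGT_zero`,
`tendsto_nhds_unique`; nothing on BCS gaps (`lean search -i 'bcs|pairingScale'`: no hits).

## References

* D. Arovas, E. Berg, S. Kivelson, S. Raghu, Annu. Rev. CMP 13 (2022) 239–274, §5.1.1–§5.1.3, §5.4.2.
* S. Raghu, S. Kivelson, D. Scalapino, PRB 81 (2010) 224505, §I, §IV.
* (narrowing) W. Kohn, J. M. Luttinger, PRL 15 (1965) 524; M. Salmhofer, *Renormalization*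
  (Springer 1999) §4.5.4; K. Yamada, *Electron Correlation in Metals* (CUP 2004) §9;
  T. Nomura, K. Yamada, J. Phys. Soc. Jpn. 72 (2003) 2053; Y. Deng, E. Kozik, N. Prokof'ev,
  B. Svistunov, EPL 110 (2015) 57001; A. Neumayr, W. Metzner, PRB 67 (2003) 035112;
  V. Mastropietro, *Non-Perturbative Renormalization* (2008) Ch. 15; C. Hainzl, R. Seiringer,
  J. Math. Phys. 57 (2016) 021101, Thms 3.2–3.3; M. Mariño, T. Reis, SciPost Phys. 13 (2022) 113.
-/

noncomputable section

open Filter Topology Real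
open Literature.Barriers.QuantumFields

namespace Literature.Barriers.HubbardSuperconductivity

/-! ### The printed scales -/

/-- **The weak-coupling pairing scale of the repulsive Hubbard model**,
`T_{c,+}(U) = W · exp(−1/(α ρ² U²))`: `W` the bandwidth, `ρ` the density of states at the Fermi
energy, `α` "an order unity constant that depends on the entire band structure". Meaningful for
`α, ρ, U > 0`; with Lean's `1/0 = 0` the value at `U = 0` (or `α = 0`, or `ρ = 0`) is the JUNK
value `W`, not the physical `T_c(0) = 0` (the barrier only uses limits along `𝓝[>] 0`). This is
LITERALLY an instance of the tree's asymptotic-scaling law: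
`repulsivePairingScale W α ρ = asymptoticScalingMass W (αρ²/2) 0`
(`repulsivePairingScale_eq_asymptoticScalingMass`), i.e. the Yang–Mills form with `β₀ = αρ²/2`
and no power prefactor (`β₁ = 0`). [cite: ArovasBergKivelsonRaghu2022, §5.1.1 p. 9 and §5.1.3 p. 13] -/
def repulsivePairingScale (W α ρ U : ℝ) : ℝ :=
  W * Real.exp (-(1 / (α * ρ ^ 2 * U ^ 2)))

/-- **The BCS scale of the attractive Hubbard model**, `T_{c,−}(U) = W · exp(−1/(ρ U))` with
`U = |U_attr|` the strength of the attraction ("BCS mean-field theory is asymptotically exact,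
and there is a superconducting instability below a characteristic scale
`T_{c,−} ∼ exp[−1/(ρ|U|)]`"; the source prints no prefactor — the common bandwidth prefactor `W`
is an interpretation of `∼`, immaterial since `W` is universally quantified in the barrier).
Meaningful for `ρ, U > 0`; the Lean value at `U = 0` (or `ρ = 0`) is the junk value `W`.
[cite: ArovasBergKivelsonRaghu2022, §5.1.1 p. 9] -/
def attractivePairingScale (W ρ U : ℝ) : ℝ :=
  W * Real.exp (-(1 / (ρ * U)))

/-- Unfolding lemma. [cite: ArovasBergKivelsonRaghu2022, §5.1.3 p. 13] -/
theorem repulsivePairingScale_def (W α ρ U : ℝ) :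
    repulsivePairingScale W α ρ U = W * Real.exp (-(1 / (α * ρ ^ 2 * U ^ 2))) :=
  rfl

/-- Unfolding lemma. [cite: ArovasBergKivelsonRaghu2022, §5.1.1 p. 9] -/
theorem attractivePairingScale_def (W ρ U : ℝ) :
    attractivePairingScale W ρ U = W * Real.exp (-(1 / (ρ * U))) :=
  rfl

/-- **Instance relation (library fit).** The repulsive pairing scale is the tree's
asymptotic-scaling mass law `asymptoticScalingMass C β₀ β₁ g = C e^{−1/(2β₀g²)} (β₀g²)^{−β₁/(2β₀²)}`
of `Literature/Barriers/QuantumFields/PerturbativeInvisibility.lean` at `C = W`, `β₀ = αρ²/2`,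
`β₁ = 0`, for ALL inputs (including the junk points). [folklore] -/
theorem repulsivePairingScale_eq_asymptoticScalingMass (W α ρ U : ℝ) :
    repulsivePairingScale W α ρ U = asymptoticScalingMass W (α * ρ ^ 2 / 2) 0 U := by
  unfold repulsivePairingScale asymptoticScalingMass
  simp only [neg_zero, zero_div, Real.rpow_zero, mul_one]
  congr 3
  ring

/-- The same as an equality of functions of `U`. [folklore] -/
theorem repulsivePairingScale_eq_asymptoticScalingMass' (W α ρ : ℝ) :
    repulsivePairingScale W α ρ = asymptoticScalingMass W (α * ρ ^ 2 / 2) 0 :=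
  funext (repulsivePairingScale_eq_asymptoticScalingMass W α ρ)

/-- `T_{c,+} > 0` for `W > 0` (for `U = 0` this is the junk value `W`). [folklore] -/
theorem repulsivePairingScale_pos {W : ℝ} (hW : 0 < W) (α ρ U : ℝ) :
    0 < repulsivePairingScale W α ρ U :=
  mul_pos hW (Real.exp_pos _)

/-- `T_{c,−} > 0` for `W > 0` (for `U = 0` this is the junk value `W`). [folklore] -/
theorem attractivePairingScale_pos {W : ℝ} (hW : 0 < W) (ρ U : ℝ) :
    0 < attractivePairingScale W ρ U :=
  mul_pos hW (Real.exp_pos _)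

/-- `T_{c,+} ≤ T_{c,−}` ("parametrically lower scale … `≪ T_{c,−}`", in its weakest exact form):
for `W ≥ 0`, `α, ρ, U > 0` with `α ρ U ≤ 1` one has `1/(ρU) ≤ 1/(αρ²U²)`.
[cite: ArovasBergKivelsonRaghu2022, §5.1.1 p. 9] -/
theorem repulsivePairingScale_le_attractive {W α ρ U : ℝ} (hW : 0 ≤ W) (hα : 0 < α)
    (hρ : 0 < ρ) (hU : 0 < U) (h : α * ρ * U ≤ 1) :
    repulsivePairingScale W α ρ U ≤ attractivePairingScale W ρ U := by
  unfold repulsivePairingScale attractivePairingScale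
  refine mul_le_mul_of_nonneg_left (Real.exp_le_exp.2 (neg_le_neg ?_)) hW
  rw [div_le_div_iff₀ (by positivity) (by positivity), one_mul, one_mul]
  calc α * ρ ^ 2 * U ^ 2 = (α * ρ * U) * (ρ * U) := by ring
    _ ≤ 1 * (ρ * U) := by gcongr
    _ = ρ * U := one_mul _

/-! ### Flatness of the two scales -/

/-- **Flatness of `T_{c,+}`.** For `α, ρ > 0`, every `W` and every order `n`,
`repulsivePairingScale W α ρ U / Uⁿ → 0` as `U → 0⁺`: the asymptotic power series of `T_{c,+}` in
`U` vanishes identically ("at zero temperature, the radius of convergence of this series is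
zero"). Derived from the tree's `PerturbativeInvisibility_holds` through the instance relation
`repulsivePairingScale_eq_asymptoticScalingMass` (nothing re-proved).
[cite: ArovasBergKivelsonRaghu2022, §5.1.1 p. 9] -/
theorem repulsivePairingScale_flat {α ρ : ℝ} (hα : 0 < α) (hρ : 0 < ρ) (W : ℝ) (n : ℕ) :
    Tendsto (fun U : ℝ => repulsivePairingScale W α ρ U / U ^ n) (𝓝[>] 0) (𝓝 0) := by
  rw [repulsivePairingScale_eq_asymptoticScalingMass']
  exact PerturbativeInvisibility_holds W (α * ρ ^ 2 / 2) 0 (by positivity) n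

/-- **Flatness of `T_{c,−}`.** For `ρ > 0`, every `W` and every order `n`,
`attractivePairingScale W ρ U / Uⁿ → 0` as `U → 0⁺` (the BCS essential singularity).
[cite: ArovasBergKivelsonRaghu2022, §5.1.1 p. 9] -/
theorem attractivePairingScale_flat {ρ : ℝ} (hρ : 0 < ρ) (W : ℝ) (n : ℕ) :
    Tendsto (fun U : ℝ => attractivePairingScale W ρ U / U ^ n) (𝓝[>] 0) (𝓝 0) := by
  set c : ℝ := 1 / ρ with hc
  have hc0 : 0 < c := by rw [hc]; positivity
  have key := (tendsto_rpow_neg_mul_exp_neg_div hc0 n).const_mul W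
  rw [mul_zero] at key
  refine key.congr' ?_
  filter_upwards [self_mem_nhdsWithin] with U hU
  have hU0 : (0 : ℝ) < U := Set.mem_Ioi.1 hU
  have h1 : (1 / (ρ * U)) = c / U := by
    rw [hc]; field_simp
  rw [attractivePairingScale_def, h1, rpow_neg hU0.le, rpow_natCast]
  ring

/-! ### The barrier -/

/-- **BARRIER `PerturbativeInvisibilityOfPairing` (ABKR 2022 §5.1.1; RKS 2010 §I, §IV).** For
all `α, ρ > 0` and every `W`, neither the weak-coupling pairing scale of the repulsive Hubbard
model `T_{c,+}(U) = W e^{−1/(αρ²U²)}` nor the BCS scale of the attractive model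
`T_{c,−}(U) = W e^{−1/(ρU)}` is perturbatively visible at `U = 0⁺` in the sense of the tree's
technique class `IsPerturbativelyVisibleAt0` (no order `n` and coefficient `a ≠ 0` with
`T_c(U)/Uⁿ → a`): their asymptotic power series in `U` vanish identically. PROVED below
(`PerturbativeInvisibilityOfPairing_holds`).

technique_class: perturbation-theory finite-order-perturbation-theory-in-U weak-coupling-power-series feynman-diagram-expansion Rayleigh-Schroedinger-expansion asymptotic-power-series-at-U=0
blocks: exhibiting the superconducting scale of the weakly repulsive square-lattice Hubbard model — `T_c`, the gap, or a ground-state `d_{x²-y²}` order parameter of the printed size, in particular the bound `m(U, δ) ≥ exp(−C/U²)` posited by route `Summits/HubbardSuperconductivity/HubbardSuperconductivity/Theses/WeakCouplingBCS.lean` crux #4 `WcbcsBcsConstruction` — by computing any finite number of orders of the expansion in `U/t` around the free Fermi gas (technique class `Literature.Barriers.QuantumFields.IsPerturbativelyVisibleAt0`, refuted for both printed scales by this theorem); "Corrections to all quantities can be expressed as an asymptotic series in `U/t`. Clearly, at zero temperature, the radius of convergence of this series is zero" [cite: ArovasBergKivelsonRaghu2022, §5.1.1 p. 9].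
because: the printed scale `T_{c,+} ∼ W exp[−1/(αρ²U²)]` [cite: ArovasBergKivelsonRaghu2022, §5.1.1 p. 9 and §5.1.3 p. 13] is flat at `U = 0⁺` — `e^{−c/U²} U^{−n} → 0` for every `n` (`repulsivePairingScale_flat`, an instance of the tree's `PerturbativeInvisibility_holds` with `β₀ = αρ²/2`, `β₁ = 0`) — as is the attractive-side BCS scale `exp[−1/(ρ|U|)]`; physically "the behavior is qualitatively distinct for `U/t → 0⁻` and `U/t → 0⁺` … the ground states on either side of `U/t = 0` are not adiabatically connected … ladders in the particle-particle (BCS) channel are logarithmically divergent so long as either time-reversal symmetry or inversion symmetry are present" [cite: ArovasBergKivelsonRaghu2022, §5.1.1 pp. 9–10]; at `T = 0` "low order perturbation theory is reliable" only above the particle–particle-ladder scale `Ω_PT` [cite: RaghuKivelsonScalapino2010, §IV p. 9].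
evasions_known: (i) the two-stage perturbative renormalization group — finite-order perturbation theory down to an intermediate cutoff `Ω₀` (cutoffs constrained by `W exp(−1/ρU) ≪ Λ₁ < Λ₂ ≪ U²/t` in the notation of [cite: ArovasBergKivelsonRaghu2022, §5.1.3 p. 13]), then the one-loop BCS flow — yields `T_c ∼ W exp[−1/(αρ²U²)]` with computable `α₂, α₁` and d-wave symmetry near half filling, "asymptotically exact" as `U/t → 0` but not a convergent expansion and without control of the `O(1)` prefactor `α₀` [cite: RaghuKivelsonScalapino2010, §I p. 2 and §IV p. 9] [cite: ArovasBergKivelsonRaghu2022, §5.1.3 p. 13]; (ii) self-consistent mean-field theories are outside the class and do produce such scales: "BCS mean-field theory is asymptotically exact" for `U → 0⁻` [cite: ArovasBergKivelsonRaghu2022, §5.1.1 p. 9], and Hartree–Fock gives `m ∼ Δ_AF ∼ exp(−1/ρU)` for the antiferromagnet at half filling (`d > 2`) [cite: ArovasBergKivelsonRaghu2022, §5.4.2 p. 20]; (iii) rigorous convergent (resummed, non-power-series) expansions exist at temperatures `T ≥ e^{−a/|U|}`, above both scales (`WeakCouplingCeiling.lean`) [cite: BenfattoGiulianiMastropietro2006,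 Theorem 1.1].
scope_caveats: PROVED here is only the flatness at `U = 0⁺` of the two printed functional forms and hence their invisibility to the class `IsPerturbativelyVisibleAt0` (one-sided limit `𝓝[>] 0`, fixed `W, α, ρ`); NOT proved or covered: (a) that the Hubbard model's `T_c`, gap or order parameter HAS the form `W e^{−1/(αρ²U²)}` — printed as "asymptotically exact" under stated assumptions, not as a theorem ("assuming the validity of certain assumptions discussed below" [cite: RaghuKivelsonScalapino2010, §I p. 2]; `α₀` not computable there), and for the pure square lattice at `t' = 0` the weak-coupling d-wave regime is "near half-filling" with `d_{xy}` taking over below `n ≈ 0.6` [cite: RaghuKivelsonScalapino2010, §III.B p. 6]; (b) methods outside the class — resummations and RG flows (evasion (i)), self-consistent gap equations, trans-series in `U` and `e^{−1/U²}`, variational, strong-coupling or numerical methods — are not obstructed; (c) the summit `HubbardSuperconductivity` quantifies `∃ U > 0` at fixed `U`, so flatness at `U → 0⁺` obstructs only approaches that pass through the weak-coupling asymptotics (such as route `WeakCouplingBCS`), not the statement itself; (d) `T_{c,±}` are temperatures/energy scales, while the summit is a ground-state statement — the transfer "gap/order parameter `∝ T_c`" is BCS lore [cite: ArovasBergKivelsonRaghu2022,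 §5.1.1 p. 9], not transcribed; (e) (barrier audit 2026-08-14, see `PerturbativeInvisibilityOfPairingNarrow` below) the class is a predicate on the OUTPUT function and is not invariant under the BCS dictionary `λ ↦ W e^{−1/λ}`: the Cooper-channel coupling `−1/log(T_{c,+}/W) = αρ²U²` IS perturbatively visible (order `2`; `ρU`, order `1`, on the attractive side), so of the technique_class words above only "asymptotic power series at `U = 0` OF `T_c`/gap/order parameter ITSELF" is covered — finite-order perturbation theory for the effective pairing vertex followed by a ladder sum, gap equation or Cooper-channel flow (Kohn–Luttinger [cite: Salmhofer1999, §4.5.4 after eq. (4.213)]; [cite: Yamada2004, §9 Fig. 9.55 and text]; [cite: DengEtAl2015, pp. 1–2]) and counterterm expansions around a gapped state [cite: NeumayrMetzner2003, abstract and §4.2] are not.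
status: established (flatness and non-visibility proved in this file; the scale `W e^{−1/(αρ²U²)}` and the zero radius of convergence are printed in [cite: ArovasBergKivelsonRaghu2022, §5.1.1 p. 9 and §5.1.3 p. 13] and [cite: RaghuKivelsonScalapino2010, §I p. 2] as asymptotically exact, non-rigorous physics)
[cite: ArovasBergKivelsonRaghu2022, §5.1.1 pp. 9–10 and §5.1.3 p. 13] -/
def PerturbativeInvisibilityOfPairing : Prop :=
  (∀ W α ρ : ℝ, 0 < α → 0 < ρ → ¬ IsPerturbativelyVisibleAt0 (repulsivePairingScale W α ρ)) ∧
    ∀ W ρ : ℝ, 0 < ρ → ¬ IsPerturbativelyVisibleAt0 (attractivePairingScale W ρ)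

/-- **Proof of the barrier.** The repulsive half IS the tree's
`not_isPerturbativelyVisibleAt0_asymptoticScalingMass` at `β₀ = αρ²/2 > 0`, `β₁ = 0` (instance
relation); for the attractive half, if `T_c(U)/Uⁿ → a` along `𝓝[>] 0` then `a = 0` by flatness and
uniqueness of limits (`𝓝[>] 0` is non-trivial). [folklore] -/
theorem PerturbativeInvisibilityOfPairing_holds : PerturbativeInvisibilityOfPairing := by
  refine ⟨fun W α ρ hα hρ => ?_, fun W ρ hρ => ?_⟩
  · rw [repulsivePairingScale_eq_asymptoticScalingMass']
    exact not_isPerturbativelyVisibleAt0_asymptoticScalingMass (by positivity)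
  · rintro ⟨n, a, ha, hlim⟩
    exact ha (tendsto_nhds_unique hlim (attractivePairingScale_flat hρ W n))

/-- Corollary (the repulsive half, for users). [folklore] -/
theorem not_isPerturbativelyVisibleAt0_repulsivePairingScale (W : ℝ) {α ρ : ℝ} (hα : 0 < α)
    (hρ : 0 < ρ) : ¬ IsPerturbativelyVisibleAt0 (repulsivePairingScale W α ρ) :=
  PerturbativeInvisibilityOfPairing_holds.1 W α ρ hα hρ

/-- Corollary in little-o form: `T_{c,+}(U) = o(Uⁿ)` as `U → 0⁺`, for every `n` (the tree's
`asymptoticScalingMass_isLittleO` through the instance relation). [folklore] -/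
theorem repulsivePairingScale_isLittleO {α ρ : ℝ} (hα : 0 < α) (hρ : 0 < ρ) (W : ℝ) (n : ℕ) :
    (fun U : ℝ => repulsivePairingScale W α ρ U) =o[𝓝[>] 0] fun U : ℝ => U ^ n := by
  rw [repulsivePairingScale_eq_asymptoticScalingMass']
  exact asymptoticScalingMass_isLittleO (by positivity) n

/-! ### Narrowing (barrier audit 2026-08-14): the BCS dictionary and what the technique class covers

`IsPerturbativelyVisibleAt0` is a predicate on a FUNCTION of the coupling. The weak-coupling
pairing scale is the image `T_c = W e^{−1/λ}` of a Cooper-channel coupling function `λ(U)` under a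
fixed elementary map, and that map destroys perturbative visibility while its inverse
`λ = −1/log(T_c/W)` restores it. Everything below is proved; nothing about the Hubbard model
itself is asserted. -/

/-- **The BCS dictionary (coupling ↦ scale).** `bcsScaleOfCoupling W λ U = W · exp(−1/λ(U))`:
the scale produced from a (positive, small) effective coupling `λ(U)` in the Cooper channel by
the ladder sum / linearised gap equation — Salmhofer's particle–particle flow
`g_k(t) = g_k(0)/(1 + 12 g_k(0) B_t^{(−)}(0))` (4.213) is singular where
`B^{(−)} = −1/(12 g_k(0))`, and `B^{(−)}(0) = ½N(0) log(βε₀/2) + O(1)` (4.203), i.e. at a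
temperature `∝ ε₀ e^{−const/|g_k(0)|}`; Hainzl–Seiringer: "the critical temperature behaves like
`T_c(λV) ∼ μ e^{1/(λ√μ e_μ(V))}` as `λ → 0`. In particular, it is exponentially small in the
coupling." Meaningful for `λ(U) > 0`; for `λ(U) = 0` Lean's `1/0 = 0` gives the junk value `W`,
for `λ(U) < 0` the junk branch `W e^{+1/|λ|}`. The two printed Hubbard scales are instances
(`repulsivePairingScale_eq_bcsScaleOfCoupling`, `attractivePairingScale_eq_bcsScaleOfCoupling`).
[cite: Salmhofer1999, §4.5.4 eqs. (4.203), (4.213)] [cite: HainzlSeiringer2016, Thm 3.2 and the sentence after it] -/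
def bcsScaleOfCoupling (W : ℝ) (lam : ℝ → ℝ) (U : ℝ) : ℝ :=
  W * Real.exp (-(1 / lam U))

/-- **The inverse dictionary (scale ↦ coupling).** `couplingOfScale W f U = −1 / log(f(U)/W)`,
the Cooper-channel coupling read off a scale `f(U)` measured in units of `W`; this is the
variable in which the rigorous weak-coupling asymptotics of the BCS functional are stated,
`lim_{λ→0} λ ln(μ/T_c(λV)) = −1/(√μ e_μ(V))`. Junk: `log 0 = 0` and `x/0 = 0` make the value
`0` wherever `f(U)/W ∈ {0, 1}` or `f(U)/W < 0` with `|f(U)/W| = 1`.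
[cite: HainzlSeiringer2016, Thm 3.2] -/
def couplingOfScale (W : ℝ) (f : ℝ → ℝ) (U : ℝ) : ℝ :=
  -1 / Real.log (f U / W)

/-- Unfolding lemma. [folklore] -/
theorem bcsScaleOfCoupling_def (W : ℝ) (lam : ℝ → ℝ) (U : ℝ) :
    bcsScaleOfCoupling W lam U = W * Real.exp (-(1 / lam U)) :=
  rfl

/-- Unfolding lemma. [folklore] -/
theorem couplingOfScale_def (W : ℝ) (f : ℝ → ℝ) (U : ℝ) :
    couplingOfScale W f U = -1 / Real.log (f U / W) :=
  rfl

/-- `T_{c,+} = W e^{−1/(αρ²U²)}` is the BCS image of the coupling `λ(U) = αρ²U²` (the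
second-order, Kohn–Luttinger-type effective attraction), definitionally.
[cite: ArovasBergKivelsonRaghu2022, §5.1.1 p. 9 and §5.1.3 p. 13] -/
theorem repulsivePairingScale_eq_bcsScaleOfCoupling (W α ρ : ℝ) :
    repulsivePairingScale W α ρ = bcsScaleOfCoupling W (fun U => α * ρ ^ 2 * U ^ 2) := by
  funext U
  rfl

/-- `T_{c,−} = W e^{−1/(ρU)}` is the BCS image of the first-order coupling `λ(U) = ρU`,
definitionally. [cite: ArovasBergKivelsonRaghu2022, §5.1.1 p. 9] -/
theorem attractivePairingScale_eq_bcsScaleOfCoupling (W ρ : ℝ) :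
    attractivePairingScale W ρ = bcsScaleOfCoupling W (fun U => ρ * U) := by
  funext U
  rfl

/-- `−1/(−(1/x)) = x` for every real `x` (also at the junk point `x = 0`). [folklore] -/
theorem neg_one_div_neg_one_div (x : ℝ) : -1 / (-(1 / x)) = x := by
  rcases eq_or_ne x 0 with rfl | hx
  · simp
  · field_simp

/-- **The inverse dictionary is a left inverse of the BCS map**, for `W ≠ 0` and EVERY coupling
function (junk values included): `−1/log((W e^{−1/λ})/W) = −1/(−1/λ) = λ`. [folklore] -/
theorem couplingOfScale_bcsScaleOfCoupling {W : ℝ} (hW : W ≠ 0) (lam : ℝ → ℝ) :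
    couplingOfScale W (bcsScaleOfCoupling W lam) = lam := by
  funext U
  unfold couplingOfScale bcsScaleOfCoupling
  rw [mul_div_cancel_left₀ _ hW, Real.log_exp, neg_one_div_neg_one_div]

/-- The coupling of the repulsive scale is the polynomial `αρ²U²` (for `W ≠ 0`; all `α, ρ`).
[folklore] -/
theorem couplingOfScale_repulsivePairingScale {W : ℝ} (hW : W ≠ 0) (α ρ : ℝ) :
    couplingOfScale W (repulsivePairingScale W α ρ) = fun U => α * ρ ^ 2 * U ^ 2 := by
  rw [repulsivePairingScale_eq_bcsScaleOfCoupling, couplingOfScale_bcsScaleOfCoupling hW]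

/-- The coupling of the attractive (BCS) scale is the polynomial `ρU` (for `W ≠ 0`; all `ρ`).
[folklore] -/
theorem couplingOfScale_attractivePairingScale {W : ℝ} (hW : W ≠ 0) (ρ : ℝ) :
    couplingOfScale W (attractivePairingScale W ρ) = fun U => ρ * U := by
  rw [attractivePairingScale_eq_bcsScaleOfCoupling, couplingOfScale_bcsScaleOfCoupling hW]

/-- `a Uⁿ / Uⁿ → a` along `𝓝[>] 0` (the quotient equals `a` for `U ≠ 0`). [folklore] -/
theorem tendsto_monomial_div_pow (a : ℝ) (n : ℕ) :
    Tendsto (fun U : ℝ => a * U ^ n / U ^ n) (𝓝[>] 0) (𝓝 a) := by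
  refine (tendsto_const_nhds (x := a)).congr' ?_
  filter_upwards [self_mem_nhdsWithin] with U hU
  have hU0 : (U : ℝ) ≠ 0 := ne_of_gt (Set.mem_Ioi.1 hU)
  field_simp

/-- A monomial `a Uⁿ` with `a ≠ 0` is perturbatively visible (order `n`, coefficient `a`): the
finite-order outputs of perturbation theory are in the class. [folklore] -/
theorem isPerturbativelyVisibleAt0_monomial {a : ℝ} (ha : a ≠ 0) (n : ℕ) :
    IsPerturbativelyVisibleAt0 (fun U => a * U ^ n) :=
  ⟨n, a, ha, tendsto_monomial_div_pow a n⟩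

/-- **The Cooper-channel coupling of `T_{c,+}` IS perturbatively visible** (order `2`,
coefficient `αρ² ≠ 0`), although `T_{c,+}` itself is not
(`not_isPerturbativelyVisibleAt0_repulsivePairingScale`): the content of "the superconducting
transition temperature has an asymptotic expansion" — in the exponent — of
Raghu–Kivelson–Scalapino, and of Kohn–Luttinger's "second-order calculation" of the initial
Cooper-channel couplings `g_k(0)`. [cite: RaghuKivelsonScalapino2010, §I p. 2 eq. (2)] [cite: Salmhofer1999, §4.5.4 after eq. (4.213)] -/
theorem isPerturbativelyVisibleAt0_couplingOfScale_repulsivePairingScale {W α ρ : ℝ} (hW : W ≠ 0)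
    (hα : α ≠ 0) (hρ : ρ ≠ 0) :
    IsPerturbativelyVisibleAt0 (couplingOfScale W (repulsivePairingScale W α ρ)) := by
  rw [couplingOfScale_repulsivePairingScale hW]
  exact isPerturbativelyVisibleAt0_monomial (a := α * ρ ^ 2) (by positivity) 2

/-- The Cooper-channel coupling of the BCS scale `T_{c,−}` is perturbatively visible at order `1`
(coefficient `ρ`): "BCS mean-field theory is asymptotically exact" for `U → 0⁻`; in the
renormalised expansion s-wave superconductivity appears "already at first order".
[cite: ArovasBergKivelsonRaghu2022, §5.1.1 p. 9] [cite: NeumayrMetzner2003, §4.2] -/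
theorem isPerturbativelyVisibleAt0_couplingOfScale_attractivePairingScale {W ρ : ℝ} (hW : W ≠ 0)
    (hρ : ρ ≠ 0) : IsPerturbativelyVisibleAt0 (couplingOfScale W (attractivePairingScale W ρ)) := by
  rw [couplingOfScale_attractivePairingScale hW]
  simpa using isPerturbativelyVisibleAt0_monomial hρ 1

/-- **`IsPerturbativelyVisibleAt0` is not invariant under the inverse BCS dictionary**: the flat
function `U ↦ e^{−1/U}` (`attractivePairingScale 1 1`) is not in the class, its coupling
`couplingOfScale 1 (e^{−1/U}) = U` is. Hence the class constrains the chosen OUTPUT variable,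
not the method that produced it. [folklore] -/
theorem isPerturbativelyVisibleAt0_not_invariant_under_couplingOfScale :
    ∃ f : ℝ → ℝ, ¬ IsPerturbativelyVisibleAt0 f ∧ IsPerturbativelyVisibleAt0 (couplingOfScale 1 f) :=
  ⟨attractivePairingScale 1 1, PerturbativeInvisibilityOfPairing_holds.2 1 1 one_pos,
    isPerturbativelyVisibleAt0_couplingOfScale_attractivePairingScale one_ne_zero one_ne_zero⟩

/-- Monotonicity of the BCS map in the coupling: `0 < l ≤ m` gives `e^{−1/l} ≤ e^{−1/m}`.
[folklore] -/
theorem exp_neg_one_div_mono {l m : ℝ} (hl : 0 < l) (hlm : l ≤ m) :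
    Real.exp (-(1 / l)) ≤ Real.exp (-(1 / m)) :=
  Real.exp_le_exp.2 (neg_le_neg (one_div_le_one_div_of_le hl hlm))

/-- **General flatness of BCS-type scales.** If the coupling is eventually positive and at most
linear near `0⁺`, `0 < λ(U) ≤ C U`, and the prefactor is eventually bounded, `|A(U)| ≤ B`, then
`A(U) e^{−1/λ(U)} / Uⁿ → 0` as `U → 0⁺` for every `n` (comparison with
`attractivePairingScale B C = B e^{−1/(CU)}` and `attractivePairingScale_flat`). This covers the
full printed form of the weak-coupling exponent with its higher corrections and any bounded
(e.g. `1 + O(U)`) prefactor, not only the two leading laws. [folklore] -/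
theorem mul_exp_neg_one_div_flat {lam A : ℝ → ℝ} {C B : ℝ} (hC : 0 < C)
    (hlam : ∀ᶠ U in 𝓝[>] (0 : ℝ), 0 < lam U ∧ lam U ≤ C * U)
    (hA : ∀ᶠ U in 𝓝[>] (0 : ℝ), |A U| ≤ B) (n : ℕ) :
    Tendsto (fun U : ℝ => A U * Real.exp (-(1 / lam U)) / U ^ n) (𝓝[>] 0) (𝓝 0) := by
  have hcmp : Tendsto (fun U : ℝ => attractivePairingScale B C U / U ^ n) (𝓝[>] 0) (𝓝 0) :=
    attractivePairingScale_flat hC B n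
  refine squeeze_zero_norm' ?_ hcmp
  filter_upwards [hlam, hA, self_mem_nhdsWithin] with U hU hAU hU0
  have hUpos : (0 : ℝ) < U := Set.mem_Ioi.1 hU0
  have hUn : (0 : ℝ) < U ^ n := pow_pos hUpos n
  rw [Real.norm_eq_abs, abs_div, abs_mul, abs_of_pos hUn, abs_of_pos (Real.exp_pos _),
    attractivePairingScale_def]
  have hB : 0 ≤ B := (abs_nonneg _).trans hAU
  have hexp : Real.exp (-(1 / lam U)) ≤ Real.exp (-(1 / (C * U))) :=
    exp_neg_one_div_mono hU.1 hU.2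
  exact div_le_div_of_nonneg_right (mul_le_mul hAU hexp (Real.exp_pos _).le hB) hUn.le

/-- From `λ(U)/Uⁿ → a > 0` with `n ≥ 1`: eventually `0 < λ(U) ≤ 2a·U` along `𝓝[>] 0`.
[folklore] -/
theorem eventually_pos_le_linear_of_tendsto {lam : ℝ → ℝ} {n : ℕ} {a : ℝ} (hn : 1 ≤ n)
    (ha : 0 < a) (h : Tendsto (fun U : ℝ => lam U / U ^ n) (𝓝[>] 0) (𝓝 a)) :
    ∀ᶠ U in 𝓝[>] (0 : ℝ), 0 < lam U ∧ lam U ≤ (2 * a) * U := by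
  have hIoo : Set.Ioo (a / 2) (2 * a) ∈ 𝓝 a := Ioo_mem_nhds (by linarith) (by linarith)
  have h1 : ∀ᶠ U in 𝓝[>] (0 : ℝ), lam U / U ^ n ∈ Set.Ioo (a / 2) (2 * a) := h hIoo
  have h2 : ∀ᶠ U in 𝓝[>] (0 : ℝ), U ∈ Set.Ioo (0 : ℝ) 1 :=
    inter_mem self_mem_nhdsWithin (mem_nhdsWithin_of_mem_nhds (Iio_mem_nhds one_pos))
  filter_upwards [h1, h2] with U hq hU
  have hU0 : 0 < U := hU.1
  have hUn : 0 < U ^ n := pow_pos hU0 n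
  have hUnle : U ^ n ≤ U := by
    calc U ^ n ≤ U ^ 1 := pow_le_pow_of_le_one hU0.le hU.2.le hn
      _ = U := pow_one U
  have hlam_eq : lam U = (lam U / U ^ n) * U ^ n := by field_simp
  constructor
  · rw [hlam_eq]
    have hpos : 0 < lam U / U ^ n := by linarith [hq.1]
    exact mul_pos hpos hUn
  · rw [hlam_eq]
    calc lam U / U ^ n * U ^ n ≤ (2 * a) * U ^ n := by gcongr; exact hq.2.le
      _ ≤ (2 * a) * U := by gcongr

/-- **The BCS dictionary sends visible couplings to flat scales.** If `λ(U)/Uⁿ → a` with `n ≥ 1`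
and `a > 0` (a perturbatively visible, asymptotically positive effective attraction that
vanishes with the bare coupling — order `1` for a bare attraction, order `2` for Kohn–Luttinger,
order `3` in `d = 2` for rotation-invariant models per Feldman–Knörrer–Sinclair–Trubowitz as
reported by Salmhofer), then `W e^{−1/λ(U)} / U^m → 0` for every `W` and every `m`.
[cite: Salmhofer1999, §4.5.4 after eq. (4.213)] -/
theorem bcsScaleOfCoupling_flat {lam : ℝ → ℝ} {n : ℕ} {a : ℝ} (hn : 1 ≤ n) (ha : 0 < a)
    (h : Tendsto (fun U : ℝ => lam U / U ^ n) (𝓝[>] 0) (𝓝 a)) (W : ℝ) (m : ℕ) :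
    Tendsto (fun U : ℝ => bcsScaleOfCoupling W lam U / U ^ m) (𝓝[>] 0) (𝓝 0) :=
  mul_exp_neg_one_div_flat (A := fun _ => W) (B := |W|) (by positivity)
    (eventually_pos_le_linear_of_tendsto hn ha h) (Eventually.of_forall fun _ => le_rfl) m

/-- Hence the BCS image of a coupling visible at order `n ≥ 1` with `a > 0` is not perturbatively
visible (flatness and uniqueness of limits along the non-trivial filter `𝓝[>] 0`). [folklore] -/
theorem not_isPerturbativelyVisibleAt0_bcsScaleOfCoupling {lam : ℝ → ℝ} {n : ℕ} {a : ℝ}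
    (hn : 1 ≤ n) (ha : 0 < a) (h : Tendsto (fun U : ℝ => lam U / U ^ n) (𝓝[>] 0) (𝓝 a))
    (W : ℝ) : ¬ IsPerturbativelyVisibleAt0 (bcsScaleOfCoupling W lam) := by
  rintro ⟨m, b, hb, hlim⟩
  exact hb (tendsto_nhds_unique hlim (bcsScaleOfCoupling_flat hn ha h W m))

/-- **NARROWED BARRIER `PerturbativeInvisibilityOfPairingNarrow` (barrier audit of
`PerturbativeInvisibilityOfPairing`, 2026-08-14).** Two conjuncts, both proved
(`PerturbativeInvisibilityOfPairingNarrow_holds`); together they imply the catalogued statement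
(`PerturbativeInvisibilityOfPairing_of_narrow`) and say exactly how far it reaches.
(1) OBSTRUCTION, generalised: for every `W`, every coupling function `λ : ℝ → ℝ` and every order
`n ≥ 1` and coefficient `a > 0` with `λ(U)/Uⁿ → a` (`U → 0⁺`), the BCS image
`U ↦ W e^{−1/λ(U)}` is not `IsPerturbativelyVisibleAt0` (it is flat, `bcsScaleOfCoupling_flat`;
the printed `T_{c,+}`: `λ = αρ²U²`, `n = 2`; the printed `T_{c,−}`: `λ = ρU`, `n = 1`; the full
printed exponent `α₂(ρU)² + α₃(ρU)³ + …` and bounded prefactors are covered by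
`mul_exp_neg_one_div_flat`). (2) THE GAP IN THE TECHNIQUE CLASS, formal: for `W ≠ 0` the inverse
dictionary `couplingOfScale W` (`= −1/log(·/W)`) sends the BCS image of ANY perturbatively
visible `λ` back into the class (it is a left inverse, `couplingOfScale_bcsScaleOfCoupling`); in
particular `−1/log(T_{c,+}/W) = αρ²U²` is visible at order `2` and `−1/log(T_{c,−}/W) = ρU` at
order `1` (`isPerturbativelyVisibleAt0_couplingOfScale_repulsivePairingScale`, `…_attractive…`),
and the class is not invariant under this fixed change of the dependent variable
(`isPerturbativelyVisibleAt0_not_invariant_under_couplingOfScale`).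

technique_class: truncated-asymptotic-power-series-in-U-of-the-target-quantity-itself (T_c, gap, or order parameter `m(U)` read off as its own leading term `a·Uⁿ`, `a ≠ 0` — the literal content of `IsPerturbativelyVisibleAt0 (U ↦ T_c U)`); NOT covered, although listed in the catalogued entry's technique_class ("perturbation-theory … finite-order-perturbation-theory-in-U … feynman-diagram-expansion"): finite-order perturbation theory / Feynman-diagram expansion in `U` for the Cooper-channel effective coupling `λ(U)` (second-order Kohn–Luttinger vertex; irreducible particle–particle vertex to order `N`) followed by the BCS dictionary (ladder sum, linearised gap / Bethe–Salpeter eigenvalue equation, one-loop Cooper-channel flow), nor renormalised (counterterm) expansions around a gapped reference state — conjunct (2).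
blocks: only reading the superconducting scale of the weakly repulsive square-lattice Hubbard model (or a lower bound for it) off the leading term of ITS OWN expansion in powers of `U` around the free Fermi gas — e.g. a bound of the form `m(U, δ) ≥ c Uⁿ`, which conjunct (1) forbids for every BCS-type scale; it does NOT block route `Summits/HubbardSuperconductivity/HubbardSuperconductivity/Theses/WeakCouplingBCS.lean` crux #4 `WcbcsBcsConstruction` (`m(U, δ) ≥ e^{−C/U²}`) from being reached through a perturbatively VISIBLE Cooper-channel coupling `λ_d(U, δ) = a_d(δ) U² + O(U³)` — crux #3 `WcbcsKohnLuttingerB1g` of that route is precisely a visibility statement for the B₁g coefficient `a_d(δ)` — plus a gap-equation / symmetry-broken-expansion step; the catalogued `blocks:` sentence "by computing any finite number of orders of the expansion in `U/t`" is true only of the final read-off, not of the computation of `λ_d`.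
because: `IsPerturbativelyVisibleAt0` is a predicate on the output function; the pairing scale is the BCS image `W e^{−1/λ}` of the Cooper-channel coupling, and this map kills visibility (conjunct (1): `0 < λ ≤ CU` eventually forces `e^{−1/λ} ≤ e^{−1/(CU)}`, flat by `attractivePairingScale_flat`) while its inverse `−1/log(·/W)` restores it (conjunct (2)); in the particle–particle flow `g_k(t) = g_k(0)/(1 + 12 g_k(0) B_t^{(−)}(0))` with `B^{(−)}(0) = ½N(0) log(βε₀/2) + O(1)` the singular scale is `ε₀ e^{−const/|g_k(0)|}` where the initial couplings `g_k(0)` come from "a second-order calculation" (Kohn–Luttinger) or "a similar third order effect" in `d = 2` (Feldman–Knörrer–Sinclair–Trubowitz) [cite: Salmhofer1999, §4.5.4 eqs. (4.203), (4.213) and the paragraph after (4.213)]; rigorously for the BCS functional the asymptotics IS a statement about the coupling of the scale: `lim_{λ→0} λ ln(μ/T_c(λV)) = −1/(√μ e_μ(V))`, `e_μ(V)` the lowest eigenvalue of an explicit operator on the Fermi sphere, refined to second order through `b_μ(λ) = infspec(λ𝒱_μ − λ²𝒲_μ)`, while `T_c` "is exponentially small in the coupling" [cite: HainzlSeiringer2016,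 Thm 3.2, Thm 3.3].
evasions_known: (i) Kohn–Luttinger: second-order perturbation theory in a purely repulsive interaction yields attractive Cooper-channel couplings `g_k(0) < 0` "for some (in general very large) `k`", and in `d = 2` a third-order effect "drives the full RG flow to an `l = 1` superconducting state" [cite: KohnLuttinger1965] [cite: Salmhofer1999, §4.5.4 after eq. (4.213)]; (ii) the exponent of `T_c` "has an asymptotic expansion" `α₂, α₃, …` computable by finite-order perturbation theory plus the one-loop Cooper flow [cite: RaghuKivelsonScalapino2010, §I p. 2] [cite: ArovasBergKivelsonRaghu2022, §5.1.3 p. 13]; (iii) perturbation expansion in `U` of the pairing vertex to third and fourth order + Dyson–Gor'kov (linearised Eliashberg) eigenvalue equation gives `T_c(U)` of the `d_{x²−y²}` state of the nearly half-filled square lattice (`t = 1`, `t' = 0.1`, `n = 0.98`, Fig. 9.55: `T_c` as a function of `U`): "the perturbation series converges smoothly for the d-wave pairing case … The fourth-order terms hardly change the critical temperature" [cite: Yamada2004, §9 Fig. 9.55 and text (chunks pp. 167–168)] [cite: NomuraYamada2003]; (iv) bold diagrammatic Monte Carlo: skeleton series for the irreducible particle–particle vertex "with explicit truncation of diagrammatic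 series at some maximum order `N`", extrapolated in `N`, then the Cooper-channel eigenvalue problem, `T_c` "exponentially small compared to the FL energy/temperature scale" — ground-state phase diagram of the 2D Hubbard model for `U ≤ 4`, `n < 0.7` [cite: DengEtAl2015, pp. 1–2]; (v) renormalised perturbation theory with symmetry-breaking counterterms, "formulated explicitly for the Hubbard model to second order in the interaction … For the repulsive Hubbard model close to half-filling we find a superconducting state with d-wave symmetry", and for `U < 0` "s-wave superconductivity already at first order, which is equivalent to BCS mean-field theory" [cite: NeumayrMetzner2003, abstract and §4.2]; its rigorous analogue for the long-range BCS interaction is a convergent expansion around the mean-field state with gap `Δ(β)` solving the BCS gap equation (15.10) and `T_c = A e^{−a/λ}` [cite: Mastropietro2008, Ch. 15 Thm 15.1 and the paragraph after (15.10)]; (vi) large-order (resurgent) visibility: for attractive Fermi systems the gap, "exponentially small in the coupling constant, and therefore … invisible in the standard perturbative approach", "determines the large order behavior of conventional many-body perturbation theory" (verified for the one-dimensional Hubbard model) [cite: MarinoReis2022, §1 p. 1].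
scope_caveats: (a) conjunct (1) needs `n ≥ 1` and `a > 0`: a coupling visible at order `0` (`λ → a ≠ 0`) gives the visible `O(1)` scale `W e^{−1/a}`, and `a < 0` (net repulsion left in the channel) gives no scale (`e^{−1/λ}`, `λ < 0`, is the junk branch); (b) NOTHING here asserts that the Hubbard model's `d_{x²−y²}` coupling `λ_d(U, δ)` is visible with `a_d(δ) > 0` at `t' = 0`, nor bounds the `O(U³)` remainder — that is route crux #3 plus open analysis; (c) evasions (iii)–(v) are non-rigorous physics at moderate `U` and do not construct a ground state; (vi)'s Thm 3.2–3.3 are for the translation-invariant continuum BCS functional with `e_μ(V) < 0`; the resurgence statement is for attractive (integrable, 1D) models — for the repulsive 2D model with scale `e^{−1/(αρ²U²)}` the corresponding large-order statement is not in the literature read; (d) as in the catalogued entry only one-sided limits `U → 0⁺` at fixed `W` (and fixed band data `α, ρ`) are formalised, and the summit quantifies `∃ U > 0`, so neither entry obstructs the summit statement itself.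
status: established (both conjuncts proved in this file; implies `PerturbativeInvisibilityOfPairing`)
[cite: Salmhofer1999, §4.5.4] [cite: HainzlSeiringer2016, Thm 3.2] -/
def PerturbativeInvisibilityOfPairingNarrow : Prop :=
  (∀ (W : ℝ) (lam : ℝ → ℝ) (n : ℕ) (a : ℝ), 1 ≤ n → 0 < a →
      Tendsto (fun U : ℝ => lam U / U ^ n) (𝓝[>] 0) (𝓝 a) →
        ¬ IsPerturbativelyVisibleAt0 (bcsScaleOfCoupling W lam)) ∧
    ∀ (W : ℝ) (lam : ℝ → ℝ), W ≠ 0 → IsPerturbativelyVisibleAt0 lam →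
      IsPerturbativelyVisibleAt0 (couplingOfScale W (bcsScaleOfCoupling W lam))

/-- **Proof of the narrowed barrier**: conjunct (1) is
`not_isPerturbativelyVisibleAt0_bcsScaleOfCoupling`; conjunct (2) is the left-inverse identity
`couplingOfScale_bcsScaleOfCoupling`. [folklore] -/
theorem PerturbativeInvisibilityOfPairingNarrow_holds : PerturbativeInvisibilityOfPairingNarrow :=
  ⟨fun W _lam _n _a hn ha h => not_isPerturbativelyVisibleAt0_bcsScaleOfCoupling hn ha h W,
    fun _W lam hW hvis => by rwa [couplingOfScale_bcsScaleOfCoupling hW lam]⟩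

/-- **The narrowed statement implies the catalogued one**: both printed scales are BCS images
of visible couplings with positive coefficient (`αρ²U²`, order `2`; `ρU`, order `1`).
[folklore] -/
theorem PerturbativeInvisibilityOfPairing_of_narrow (h : PerturbativeInvisibilityOfPairingNarrow) :
    PerturbativeInvisibilityOfPairing := by
  refine ⟨fun W α ρ hα hρ => ?_, fun W ρ hρ => ?_⟩
  · rw [repulsivePairingScale_eq_bcsScaleOfCoupling]
    exact h.1 W _ 2 (α * ρ ^ 2) (by norm_num) (by positivity) (tendsto_monomial_div_pow _ 2)
  · rw [attractivePairingScale_eq_bcsScaleOfCoupling]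
    refine h.1 W _ 1 ρ le_rfl hρ ?_
    simpa using tendsto_monomial_div_pow ρ 1

end Literature.Barriers.HubbardSuperconductivity

end
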